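import Summits.NavierStokesRegularity.NavierStokesRegularity.Theses.AdaptedFrequency
import Literature.Analysis.FluidPDE.AdaptedBackwardKernel
import Summits.NavierStokesRegularity.NavierStokesRegularity.Theorems.AdaptedFrequencyAdaptedFrequencyConvergesStubPinchingLower
import Summits.NavierStokesRegularity.NavierStokesRegularity.Theorems.AdaptedFrequencyAdaptedFrequencyConvergesStubFrequencyCeiling
import Summits.NavierStokesRegularity.NavierStokesRegularity.Theorems.AdaptedFrequencyAdaptedFrequencyConvergesStubEnstrophyC2

/-!
# Line `unsteadiness-squeeze` — skeleton for crux `AdaptedFrequencyConverges`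
(stmt-NavierStokesRegularity-10493; lead prover-line-stmt-NavierStokesRegularity-10493-1)

Rebuilt from the registered stub signatures of planner-cruxplan-…-unsteadiness-squeeze
(ledger archive ids 76741, 77460–77462; the planner's `Lines/unsteadiness-squeeze.lean` never
reached the tree and the evidence store is not mounted in the lead's jail) and RESHAPED by the
lead:

* the planner's lost definition `bandPolynomialAt ν u G T x₀ τ` ("instantaneous band polynomial
  `P = 4a² − 4κa + 2σ`", a lower bound for `dΛ/ds` by the conjugated-frame Agmon–Nirenberg
  identity `N′‖v‖² = 2‖(𝓢−N)v‖² + 2⟨(𝓢−N)v, 𝒦v⟩ + ⟨𝓢′v, v⟩`, `Λ = 2 + 2N`, triage App. A) is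
  rebuilt at its honest core `P τ := (T − τ) · dΛ/dt (τ) = dΛ/ds` and INLINED, so that every stub
  is stated in tree vocabulary only; with this `P` the planner's `stub_upperJaw`
  (`∫ₜ^{t'} P/(T−τ) ≤ Λ t' − Λ t`) is the fundamental theorem of calculus for `Λ`, whose analytic
  content is second-order kernel calculus — registered here as `stub_enstrophyC2` (`H ∈ C²` near
  `T`) — and `stub_bandExclusion` (`P ≥ 0` on a final window) is the WEAKEST statement the line's
  composition can consume (strictly weaker than the planner's `4a² − 4κa + 2σ ≥ 0`);
* `stub_enstrophyFloor` is, up to the name of a bound variable, the LANDED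
  `TauberianOmegaLimit.stub_pinchingLower` (p82804) and is discharged by reference.

Composition (sorry-free modulo the registered stubs):
* `stub_enstrophyFloor` — `0 < c ≤ (T−t)² H` near `T` (landed; the far-field step);
* `stub_enstrophyC2` [registered] — `H = adaptedEnstrophy u G` is `C²` on a left
  neighbourhood of `T` (second-order transport-free kernel calculus: `H′ = ∫ 𝓛‖ω‖² G`,
  `H″ = ∫ 𝓛²‖ω‖² G`, `𝓛 = ∂ₜ + u·∇ − νΔ`; pressure enters `H″` through `∂ₜ∇u`);
* `stub_upperJaw` (derived, real analysis) — with the floor, `Λ = (T−t)H′/H ∈ C¹` near `T`, so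
  `∫ₜ^{t'} Λ′ = Λ t' − Λ t` on late windows;
* `stub_bandExclusion` [registered; hardest; held by the lead] — `(T−τ)·Λ′(τ) ≥ 0` on a final
  window (the card's regime statement: outside the breathing band the Agmon–Nirenberg gain beats
  the defect; ≥ slow decrease, hence ≥ the crux modulo the landed stubs — Negative/SlowDecreaseOfCrux);
* `stub_frequencyCeiling` [registered] — `Λ ≤ M` near `T` (kernel calculus `H′ ≤ 2‖∇u‖∞ H`,
  Type-I gradient bound `‖∇u(t)‖∞ ≲ (T−t)⁻¹`, floor `H > 0`).
Then `Λ` is non-decreasing and bounded above on a final window, hence converges: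
`AdaptedFrequencyConverges_of`.

STATUS (2026-08-16, cycle 1): stub_frequencyCeiling LANDED (p96525,
`Theorems/AdaptedFrequencyAdaptedFrequencyConvergesStubFrequencyCeiling.lean`) and stub_enstrophyC2
LANDED (p103653, `…StubEnstrophyC2.lean`, tools p99580, jet p101432), namespace
`…Theorems.AdaptedFrequencyConverges.UnsteadinessSqueeze`; both are discharged below by reference.
The only remaining `sorry` is `stub_bandExclusion` (held by the lead).  VERDICT (lead -1, 14:35Z):
LINE DEAD at `stub_bandExclusion` — it is ≥ the crux (reduction
`adaptedFrequencyConverges_of_bandExclusion`, p105957) and forces a hidden Giga–Kohn-type monotone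
clock `(T−t)²H ↓ h₀ > 0` with `Λ ≤ 2` (`Negative/BandExclusionHiddenMonotonicity.lean`, p107589);
see `Lines/unsteadiness-squeeze.dead.md`.
-/

noncomputable section

namespace Summit.NavierStokesRegularity.NavierStokesRegularity.Cruxes.AdaptedFrequencyConverges.Lines.UnsteadinessSqueeze

open scoped Topology
open Literature.Analysis.FluidPDE Set Filter MeasureTheory
open Summit.NavierStokesRegularity.NavierStokesRegularity.Theses.AdaptedFrequency

/-! ## Registered stubs (`--supports stmt-NavierStokesRegularity-10493`; the two landed ones are discharged by reference) -/

/-- **Frequency ceiling**: the adapted frequency is bounded above near `T`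
(`H′ = 2∫(⟨ω,(∇u)ω⟩ − ν|∇ω|²)G ≤ 2‖∇u(t)‖∞ H`, `‖∇u(t)‖∞ ≤ K/(T−t)` under Type I, `H > 0` by the
floor). -/
theorem stub_frequencyCeiling :
    ∀ (ν T : ℝ) (u : ℝ → EuclideanSpace ℝ (Fin 3) → EuclideanSpace ℝ (Fin 3)) (p : ℝ → EuclideanSpace ℝ (Fin 3) → ℝ) (x₀ : EuclideanSpace ℝ (Fin 3)) (t₀ : ℝ) (G : ℝ → EuclideanSpace ℝ (Fin 3) → ℝ), 0 < ν → 0 < T → IsClassicalNSSolutionOn (Ico 0 T) ν 0 u p → IsLerayHopfOn T ν 0 (u 0) u → HasRapidSpatialDecay (u 0) → IsTypeIBlowup u T → t₀ ∈ Ico 0 T → (∀ r : ℝ, 0 < r → eLpNorm (Function.uncurry u) ⊤ (volume.restrict (parabolicCylinder r (T, x₀))) = ⊤) → IsAdaptedBackwardKernel ν u (Ico t₀ T) T x₀ G → IsGaussianComparable G (Ico t₀ T) T x₀ → ∃ t₁ ∈ Ico t₀ T, ∃ M : ℝ, ∀ t ∈ Ico t₁ T, adaptedFrequency u G T t ≤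 M :=
  Summit.NavierStokesRegularity.NavierStokesRegularity.Theorems.AdaptedFrequencyConverges.UnsteadinessSqueeze.stub_frequencyCeiling

/-- **Second-order kernel calculus**: the adapted enstrophy `H(t) = ∫ ‖curl u(t)‖² G(t)` is `C²`
on a left neighbourhood of `T` (expected: `H′(t) = ∫ 𝓛‖ω‖² G`, `H″(t) = ∫ 𝓛(𝓛‖ω‖²) G`,
`𝓛 = ∂ₜ + u·∇ − νΔ`, by two applications of the transport-free first variation against the
adapted kernel on windows where all derivatives of `u` and `∇p` are bounded). -/
theorem stub_enstrophyC2 :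
    ∀ (ν T : ℝ) (u : ℝ → EuclideanSpace ℝ (Fin 3) → EuclideanSpace ℝ (Fin 3)) (p : ℝ → EuclideanSpace ℝ (Fin 3) → ℝ) (x₀ : EuclideanSpace ℝ (Fin 3)) (t₀ : ℝ) (G : ℝ → EuclideanSpace ℝ (Fin 3) → ℝ), 0 < ν → 0 < T → IsClassicalNSSolutionOn (Ico 0 T) ν 0 u p → IsLerayHopfOn T ν 0 (u 0) u → HasRapidSpatialDecay (u 0) → IsTypeIBlowup u T → t₀ ∈ Ico 0 T → (∀ r : ℝ, 0 < r → eLpNorm (Function.uncurry u) ⊤ (volume.restrict (parabolicCylinder r (T, x₀))) = ⊤) → IsAdaptedBackwardKernel ν u (Ico t₀ T) T x₀ G → IsGaussianComparable G (Ico t₀ T) T x₀ → ∃ t₁ ∈ Ico t₀ T, ContDiffOn ℝ 2 (adaptedEnstrophy u G) (Ioo t₁ T) :=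
  Summit.NavierStokesRegularity.NavierStokesRegularity.Theorems.AdaptedFrequencyConverges.UnsteadinessSqueeze.stub_enstrophyC2

/-- **Band exclusion** [hardest stub; the NS content]: given the enstrophy floor, the rebuilt
band polynomial `P τ = (T − τ) · Λ′(τ)` (`= dΛ/ds`, of which the card's `4a² − 4κa + 2σ` is a
lower bound) is nonnegative on a final window `[t₂, T)`. -/
theorem stub_bandExclusion :
    ∀ (ν T : ℝ) (u : ℝ → EuclideanSpace ℝ (Fin 3) → EuclideanSpace ℝ (Fin 3)) (p : ℝ → EuclideanSpace ℝ (Fin 3) → ℝ) (x₀ : EuclideanSpace ℝ (Fin 3)) (t₀ : ℝ) (G : ℝ → EuclideanSpace ℝ (Fin 3) → ℝ), 0 < ν → 0 < T → IsClassicalNSSolutionOn (Ico 0 T) ν 0 u p → IsLerayHopfOn T ν 0 (u 0) u → HasRapidSpatialDecay (u 0) → IsTypeIBlowup u T → t₀ ∈ Ico 0 T → (∀ r : ℝ, 0 < r → eLpNorm (Function.uncurry u) ⊤ (volume.restrict (parabolicCylinder r (T, x₀))) = ⊤) → IsAdaptedBackwardKernel ν u (Ico t₀ T) T x₀ G → IsGaussianComparable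 G (Ico t₀ T) T x₀ → ∀ (t₁ c : ℝ), t₁ ∈ Ico t₀ T → 0 < c → (∀ t ∈ Ico t₁ T, c ≤ (T - t) ^ 2 * adaptedEnstrophy u G t) → ∃ t₂ ∈ Ico t₁ T, ∀ τ ∈ Ico t₂ T, 0 ≤ (T - τ) * deriv (adaptedFrequency u G T) τ := by
  sorry

/-! ## Discharged / derived stubs -/

/-- **Enstrophy floor** `0 < c ≤ (T−t)² H(t)` near `T`: the landed far-field step
(`TauberianOmegaLimit.stub_pinchingLower`, p82804 — Barker–Prange `L³` concentration at the
singular point, Type-I Morrey bound, local Biot–Savart/Poincaré, Gaussian lower comparability). -/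
theorem stub_enstrophyFloor :
    ∀ (ν T : ℝ) (u : ℝ → EuclideanSpace ℝ (Fin 3) → EuclideanSpace ℝ (Fin 3)) (p : ℝ → EuclideanSpace ℝ (Fin 3) → ℝ) (x₀ : EuclideanSpace ℝ (Fin 3)) (t₀ : ℝ) (G : ℝ → EuclideanSpace ℝ (Fin 3) → ℝ), 0 < ν → 0 < T → IsClassicalNSSolutionOn (Ico 0 T) ν 0 u p → IsLerayHopfOn T ν 0 (u 0) u → HasRapidSpatialDecay (u 0) → IsTypeIBlowup u T → t₀ ∈ Ico 0 T → (∀ r : ℝ, 0 < r → eLpNorm (Function.uncurry u) ⊤ (volume.restrict (parabolicCylinder r (T, x₀))) = ⊤) → IsAdaptedBackwardKernel ν u (Ico t₀ T) T x₀ G → IsGaussianComparable G (Ico t₀ T) T x₀ → ∃ t₁ ∈ Ico t₀ T, ∃ c : ℝ, 0 < c ∧ ∀ t ∈ Ico t₁ T, c ≤ (T - t) ^ 2 * adaptedEnstrophy u G t :=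
  Summit.NavierStokesRegularity.NavierStokesRegularity.Theorems.AdaptedFrequencyConverges.TauberianOmegaLimit.stub_pinchingLower

/-- **Real-analysis core of the upper jaw.** If `H` is `C²` and positive on `(a, T)`, then
`Λ t = (T − t) H′(t)/H(t)` is `C¹` there, so on every `[t, t'] ⊂ (a, T)` its derivative is
interval-integrable and `∫ₜ^{t'} Λ′ = Λ t' − Λ t`. -/
theorem upperJaw_of_contDiffOn {H : ℝ → ℝ} {a T : ℝ}
    (hC2 : ContDiffOn ℝ 2 H (Ioo a T)) (hpos : ∀ t ∈ Ioo a T, 0 < H t) {t t' : ℝ}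
    (hat : a < t) (htt' : t ≤ t') (ht'T : t' < T) :
    IntervalIntegrable (fun τ => deriv (fun s => (T - s) * deriv H s / H s) τ) volume t t' ∧
      ∫ τ in t..t', deriv (fun s => (T - s) * deriv H s / H s) τ =
        (T - t') * deriv H t' / H t' - (T - t) * deriv H t / H t := by
  have hopen : IsOpen (Ioo a T) := isOpen_Ioo
  -- `H′` is `C¹` on the window
  have hH1 : ContDiffOn ℝ 1 (deriv H) (Ioo a T) := by
    have h2 : ContDiffOn ℝ (1 + 1) H (Ioo a T) := by
      simpa [show ((1 : WithTop ℕ∞) + 1) = 2 by norm_num] using hC2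
    exact ((contDiffOn_succ_iff_deriv_of_isOpen hopen).1 h2).2.2
  have hH1' : ContDiffOn ℝ 1 H (Ioo a T) := hC2.of_le (by norm_num)
  -- `Λ` is `C¹` on the window
  have hΛ : ContDiffOn ℝ 1 (fun s => (T - s) * deriv H s / H s) (Ioo a T) := by
    refine ContDiffOn.div ?_ hH1' (fun s hs => (hpos s hs).ne')
    exact (contDiffOn_const.sub contDiffOn_id).mul hH1
  have hΛd : DifferentiableOn ℝ (fun s => (T - s) * deriv H s / H s) (Ioo a T) :=
    hΛ.differentiableOn one_ne_zero
  have hΛ' : ContinuousOn (deriv fun s => (T - s) * deriv H s / H s) (Ioo a T) := by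
    have h1 : ContDiffOn ℝ (0 + 1) (fun s => (T - s) * deriv H s / H s) (Ioo a T) := by
      simpa using hΛ
    exact (((contDiffOn_succ_iff_deriv_of_isOpen hopen).1 h1).2.2).continuousOn
  have hsub : uIcc t t' ⊆ Ioo a T := by
    rw [uIcc_of_le htt']
    exact fun s hs => ⟨hat.trans_le hs.1, hs.2.trans_lt ht'T⟩
  have hint : IntervalIntegrable (fun τ => deriv (fun s => (T - s) * deriv H s / H s) τ)
      volume t t' :=
    (hΛ'.mono hsub).intervalIntegrable
  refine ⟨hint, ?_⟩
  exact intervalIntegral.integral_deriv_eq_sub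
    (fun s hs => (hΛd s (hsub hs)).differentiableAt (hopen.mem_nhds (hsub hs))) hint

/-- **Upper jaw** (the planner's `stub_upperJaw` with the rebuilt band polynomial
`P τ/(T−τ) = Λ′(τ)`): given the floor, on late windows `Λ′` is interval-integrable and
`∫ₜ^{t'} Λ′ ≤ Λ t' − Λ t`. Derived from `stub_enstrophyC2` and `upperJaw_of_contDiffOn`. -/
theorem stub_upperJaw :
    ∀ (ν T : ℝ) (u : ℝ → EuclideanSpace ℝ (Fin 3) → EuclideanSpace ℝ (Fin 3)) (p : ℝ → EuclideanSpace ℝ (Fin 3) → ℝ) (x₀ : EuclideanSpace ℝ (Fin 3)) (t₀ : ℝ) (G : ℝ → EuclideanSpace ℝ (Fin 3) → ℝ), 0 < ν → 0 < T → IsClassicalNSSolutionOn (Ico 0 T) ν 0 u p → IsLerayHopfOn T ν 0 (u 0) u → HasRapidSpatialDecay (u 0) → IsTypeIBlowup u T → t₀ ∈ Ico 0 T → (∀ r : ℝ, 0 < r → eLpNorm (Function.uncurry u) ⊤ (volume.restrict (parabolicCylinder r (T, x₀))) = ⊤) → IsAdaptedBackwardKernel ν u (Ico t₀ T) T x₀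 G → IsGaussianComparable G (Ico t₀ T) T x₀ → ∀ (t₁ c : ℝ), t₁ ∈ Ico t₀ T → 0 < c → (∀ t ∈ Ico t₁ T, c ≤ (T - t) ^ 2 * adaptedEnstrophy u G t) → ∃ t₂ ∈ Ico t₁ T, ∀ t t' : ℝ, t₂ ≤ t → t ≤ t' → t' < T → IntervalIntegrable (fun τ => deriv (adaptedFrequency u G T) τ) volume t t' ∧ ∫ τ in t..t', deriv (adaptedFrequency u G T) τ ≤ adaptedFrequency u G T t' - adaptedFrequency u G T t := by
  intro ν T u p x₀ t₀ G hν hT hcl hLH hdec hTI ht₀ hsing hker hcmp t₁ c ht₁ hc hfloor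
  obtain ⟨a, ha, hC2⟩ := stub_enstrophyC2 ν T u p x₀ t₀ G hν hT hcl hLH hdec hTI ht₀ hsing hker hcmp
  -- the window `(a', T)`, `a' = max a t₁`, on which `H` is `C²` and positive
  set a' : ℝ := max a t₁ with ha'
  have ha'T : a' < T := max_lt ha.2 ht₁.2
  have hC2' : ContDiffOn ℝ 2 (adaptedEnstrophy u G) (Ioo a' T) :=
    hC2.mono (Ioo_subset_Ioo_left (le_max_left _ _))
  have hpos : ∀ t ∈ Ioo a' T, 0 < adaptedEnstrophy u G t := by
    intro t ht
    have h1 : c ≤ (T - t) ^ 2 * adaptedEnstrophy u G t :=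
      hfloor t ⟨(le_max_right _ _).trans ht.1.le, ht.2⟩
    have h2 : 0 < (T - t) ^ 2 := by
      have : 0 < T - t := sub_pos.2 ht.2
      positivity
    by_contra hle
    push Not at hle
    have : (T - t) ^ 2 * adaptedEnstrophy u G t ≤ 0 :=
      mul_nonpos_of_nonneg_of_nonpos h2.le hle
    linarith
  refine ⟨(a' + T) / 2, ⟨?_, by linarith⟩, ?_⟩
  · have : t₁ ≤ a' := le_max_right _ _
    linarith
  intro t t' h2t htt' ht'T
  have hat : a' < t := by linarith
  have key := upperJaw_of_contDiffOn hC2' hpos hat htt' ht'T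
  have hfun : adaptedFrequency u G T =
      fun s => (T - s) * deriv (adaptedEnstrophy u G) s / adaptedEnstrophy u G s := by
    funext s; rfl
  rw [hfun]
  exact ⟨key.1, key.2.le⟩

/-! ## Composition -/

/-- The line closes the crux: `Λ` is non-decreasing (floor + upper jaw + band exclusion) and
bounded above (ceiling) on a final window, hence has a left limit at `T`. -/
theorem AdaptedFrequencyConverges_of : AdaptedFrequencyConverges := by
  intro ν T hν hT u p hcl hLH hdec hTI x₀ t₀ G ht₀ hsing hK hcomp H Λ hH hΛ
  have hker : IsAdaptedBackwardKernel ν u (Ico t₀ T) T x₀ G := isAdaptedBackwardKernel_iff.2 hK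
  have hcmp : IsGaussianComparable G (Ico t₀ T) T x₀ := isGaussianComparable_iff_fin_three.2 hcomp
  -- `H` is the adapted enstrophy, `Λ` the adapted frequency
  have hH' : H = adaptedEnstrophy u G := by
    rw [hH]; funext t; rfl
  have hΛ' : Λ = adaptedFrequency u G T := by
    rw [hΛ, hH']; funext t; rfl
  rw [hΛ']
  -- floor
  obtain ⟨t₁, ht₁, c, hc, hfloor⟩ :=
    stub_enstrophyFloor ν T u p x₀ t₀ G hν hT hcl hLH hdec hTI ht₀ hsing hker hcmp
  -- upper jaw and band exclusion above the floor
  obtain ⟨t₂, ht₂, hjaw⟩ :=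
    stub_upperJaw ν T u p x₀ t₀ G hν hT hcl hLH hdec hTI ht₀ hsing hker hcmp t₁ c ht₁ hc hfloor
  obtain ⟨t₃, ht₃, hband⟩ :=
    stub_bandExclusion ν T u p x₀ t₀ G hν hT hcl hLH hdec hTI ht₀ hsing hker hcmp t₁ c ht₁ hc hfloor
  -- ceiling
  obtain ⟨t₄, ht₄, M, hceil⟩ :=
    stub_frequencyCeiling ν T u p x₀ t₀ G hν hT hcl hLH hdec hTI ht₀ hsing hker hcmp
  -- a common final window `(t₅, T)`
  set t₅ : ℝ := max (max t₂ t₃) t₄ with ht₅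
  have ht₅T : t₅ < T := max_lt (max_lt ht₂.2 ht₃.2) ht₄.2
  have h25 : t₂ ≤ t₅ := (le_max_left _ _).trans (le_max_left _ _)
  have h35 : t₃ ≤ t₅ := (le_max_right _ _).trans (le_max_left _ _)
  have h45 : t₄ ≤ t₅ := le_max_right _ _
  -- `Λ′ ≥ 0` on the window
  have hderiv : ∀ τ ∈ Ioo t₅ T, 0 ≤ deriv (adaptedFrequency u G T) τ := by
    intro τ hτ
    have h1 : 0 ≤ (T - τ) * deriv (adaptedFrequency u G T) τ :=
      hband τ ⟨h35.trans hτ.1.le, hτ.2⟩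
    have h2 : 0 < T - τ := sub_pos.2 hτ.2
    exact (mul_nonneg_iff_of_pos_left h2).1 h1
  -- `Λ` is non-decreasing on the window
  have hmono : MonotoneOn (adaptedFrequency u G T) (Ioo t₅ T) := by
    intro t ht t' ht' htt'
    obtain ⟨_, hle⟩ := hjaw t t' (h25.trans ht.1.le) htt' ht'.2
    have hnn : 0 ≤ ∫ τ in t..t', deriv (adaptedFrequency u G T) τ :=
      intervalIntegral.integral_nonneg htt' fun τ hτ =>
        hderiv τ ⟨ht.1.trans_le hτ.1, hτ.2.trans_lt ht'.2⟩
    linarith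
  -- `Λ` is bounded above on the window
  have hbdd : BddAbove (adaptedFrequency u G T '' Ioo t₅ T) := by
    refine ⟨M, ?_⟩
    rintro _ ⟨t, ht, rfl⟩
    exact hceil t ⟨h45.trans ht.1.le, ht.2⟩
  exact ⟨_, MonotoneOn.tendsto_nhdsWithin_Ioo_left (nonempty_Ioo.2 ht₅T) hmono hbdd⟩

end Summit.NavierStokesRegularity.NavierStokesRegularity.Cruxes.AdaptedFrequencyConverges.Lines.UnsteadinessSqueeze

end
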